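import Summits.MatrixMultiplication.OmegaCensus.BoxUsefulCentrelessAbelian

/-!
# ω-census, family (b3): conjecture C9 (b) — centreless endgame, part 3: a signed (dihedral-type) centraliser is impossible

HONEST FRAMING (pub-omega census; verbatim): lottery ticket; floor = certified bounds/negative ranges.
Census BOOKKEEPING (conjecture C9 of the cell, STRUCTURE.md §2; pub-omega kernel-l4 gen 16, task K-5, structure part; the
centreless branch, endgame part 3).  Setting as in parts 1–2 (`a` of order `3`, every element centralises or inverts `a`, `t`
an inverter, `C = C_G(a)`), plus a SIGN on `C`: a function `ε : C → {±1}`, multiplicative on `C`, such that two elements of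
sign `+1` commute and have cube `1`, an involution `y ∈ C` of sign `−1`, and an element `u ≠ 1 = u³` of `C` inverted by `y`.
This is exactly what the induction hypothesis hands us when `C` is lawful and non-abelian (`[C : Z(C)] = 6`: the `Coord`
package of `CentreIndexSixCoord`; `C ∈ 𝒞₂`: the `Coord2` package; in both cases `ε`'s kernel modulo `K` is `Z(C)`, an
elementary abelian `3`-group by part 2) — the translation is part 4.
* `Endgame.false_of_signed_centralizer`: such a `G` is not box-useful.  Proof: `t² ∈ C`; if `ε(t²) = −1` then
  `t² u t⁻² = u⁻¹` and `u, t u t⁻¹` commute — the faithful `C₃² ⋊ C₄` configuration (`C3C3C4Config`); if `ε(t²) = +1`,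
  first replace `t` by `t c` (`c ∈ C`) so that `t` commutes with `y` (the involutions `t⁻¹ y t = m y` of sign `−1` are
  `C`-conjugate to `y`: `c = m²`), then with `v = t u t⁻¹` the element `w = u v` is `t`-fixed and `y`-inverted: if `w ≠ 1`
  the `S₃ × S₃` configuration `(a, t; w, y)` applies, and if `w = 1` (i.e. `t` inverts `u`) the configuration `(a, t y; u, y)`
  does (`S3S3Config`).
Nothing here is progress on `ω`.
-/

namespace Summit.MatrixMultiplication.OmegaCensus

open Finset ProductBoxBound
open scoped commutatorElement

namespace Endgame

variable {G : Type*} [Group G] [Fintype G] [DecidableEq G]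

omit [Fintype G] [DecidableEq G] in
/-- An inverter of `a` also satisfies `t⁻¹ a t = a⁻¹`. [folklore] -/
theorem inv_conj_of_inverter {a t : G} (hta : t * a * t⁻¹ = a⁻¹) : t⁻¹ * a * t = a⁻¹ := by
  calc t⁻¹ * a * t = t⁻¹ * (t * a * t⁻¹)⁻¹ * t := by rw [hta, inv_inv]
    _ = a⁻¹ := by group

omit [Fintype G] [DecidableEq G] in
/-- Conjugating a centraliser of `a` by an inverter of `a` gives a centraliser of `a`. [folklore] -/
theorem cent_conj_of_inverter {a t c : G} (hta : t * a * t⁻¹ = a⁻¹) (hc : c * a * c⁻¹ = a) :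
    (t * c * t⁻¹) * a * (t * c * t⁻¹)⁻¹ = a := by
  have h1 : c * a⁻¹ * c⁻¹ = a⁻¹ := by rw [show c * a⁻¹ * c⁻¹ = (c * a * c⁻¹)⁻¹ by group, hc]
  have h2 : t * a⁻¹ * t⁻¹ = a := by rw [show t * a⁻¹ * t⁻¹ = (t * a * t⁻¹)⁻¹ by group, hta, inv_inv]
  calc (t * c * t⁻¹) * a * (t * c * t⁻¹)⁻¹ = t * (c * (t⁻¹ * a * t) * c⁻¹) * t⁻¹ := by group
    _ = a := by rw [inv_conj_of_inverter hta, h1, h2]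

omit [Fintype G] [DecidableEq G] in
/-- The same for `t⁻¹`. [folklore] -/
theorem cent_conj_of_inverter' {a t c : G} (hta : t * a * t⁻¹ = a⁻¹) (hc : c * a * c⁻¹ = a) :
    (t⁻¹ * c * t) * a * (t⁻¹ * c * t)⁻¹ = a := by
  have hta' : t⁻¹ * a * t⁻¹⁻¹ = a⁻¹ := by rw [inv_inv]; exact inv_conj_of_inverter hta
  have := cent_conj_of_inverter hta' hc
  rwa [inv_inv] at this

omit [Fintype G] [DecidableEq G] in
/-- `t²` centralises `a`. [folklore] -/
theorem sq_cent_of_inverter {a t : G} (hta : t * a * t⁻¹ = a⁻¹) : (t * t) * a * (t * t)⁻¹ = a := by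
  calc (t * t) * a * (t * t)⁻¹ = t * (t * a * t⁻¹) * t⁻¹ := by group
    _ = a := by rw [hta, show t * a⁻¹ * t⁻¹ = (t * a * t⁻¹)⁻¹ by group, hta, inv_inv]

/-- The core of the signed endgame, for an inverter `t` that commutes with `y` and has `ε(t²) = 1`. [folklore] -/
private theorem false_of_signed_aux (hG : BoxUseful G) {a t y u : G} (ε : G → ZMod 3)
    (ha3 : a ^ 3 = 1) (ha1 : a ≠ 1) (hta : t * a * t⁻¹ = a⁻¹)
    (hcomm : ∀ c d : G, c * a * c⁻¹ = a → d * a * d⁻¹ = a → ε c = 1 → ε d = 1 → c * d = d * c)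
    (hε3 : ∀ c : G, c * a * c⁻¹ = a → c ^ 3 = 1 → ε c = 1)
    (hy : y * a * y⁻¹ = a) (hy2 : y * y = 1)
    (hu : u * a * u⁻¹ = a) (hu3 : u ^ 3 = 1) (hu1 : u ≠ 1) (hyu : y * u * y⁻¹ = u⁻¹)
    (hty : t * y = y * t) (hεtt : ε (t * t) = 1) : False := by
  have hzu : a * u = u * a := (mul_inv_eq_iff_eq_mul.1 hu).symm
  have hεu : ε u = 1 := hε3 u hu hu3
  have htt := sq_cent_of_inverter hta
  -- `v = t u t⁻¹`
  have hv : (t * u * t⁻¹) * a * (t * u * t⁻¹)⁻¹ = a := cent_conj_of_inverter hta hu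
  have hv3 : (t * u * t⁻¹) ^ 3 = 1 := by rw [CentreLift.conj_pow', hu3]; group
  have hεv : ε (t * u * t⁻¹) = 1 := hε3 _ hv hv3
  have huv : u * (t * u * t⁻¹) = (t * u * t⁻¹) * u := hcomm _ _ hu hv hεu hεv
  have hyv : y * (t * u * t⁻¹) * y⁻¹ = (t * u * t⁻¹)⁻¹ := by
    calc y * (t * u * t⁻¹) * y⁻¹ = (y * t) * u * (y * t)⁻¹ := by group
      _ = t * (y * u * y⁻¹) * t⁻¹ := by rw [← hty]; group
      _ = (t * u * t⁻¹)⁻¹ := by rw [hyu]; group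
  have httu : t * t * u * t⁻¹ * t⁻¹ = u := by
    have e := hcomm _ _ htt hu hεtt hεu
    calc t * t * u * t⁻¹ * t⁻¹ = (t * t * u) * (t * t)⁻¹ := by group
      _ = u := by rw [e]; group
  -- `w = u v` is `t`-fixed and `y`-inverted
  have htw : t * (u * (t * u * t⁻¹)) * t⁻¹ = u * (t * u * t⁻¹) := by
    calc t * (u * (t * u * t⁻¹)) * t⁻¹ = (t * u * t⁻¹) * (t * t * u * t⁻¹ * t⁻¹) := by group
      _ = u * (t * u * t⁻¹) := by rw [httu, huv]
  have hyw : y * (u * (t * u * t⁻¹)) * y⁻¹ = (u * (t * u * t⁻¹))⁻¹ := by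
    calc y * (u * (t * u * t⁻¹)) * y⁻¹ = (y * u * y⁻¹) * (y * (t * u * t⁻¹) * y⁻¹) := by group
      _ = u⁻¹ * (t * u * t⁻¹)⁻¹ := by rw [hyu, hyv]
      _ = ((t * u * t⁻¹) * u)⁻¹ := by group
      _ = (u * (t * u * t⁻¹))⁻¹ := by rw [huv]
  have hcuv : Commute u (t * u * t⁻¹) := huv
  have hw3 : (u * (t * u * t⁻¹)) ^ 3 = 1 := by
    rw [hcuv.mul_pow, hu3, hv3, one_mul]
  have haw : a * (u * (t * u * t⁻¹)) = (u * (t * u * t⁻¹)) * a :=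
    (mul_inv_eq_iff_eq_mul.1 (cent_mul hu hv)).symm
  by_cases hw : u * (t * u * t⁻¹) = 1
  · -- `t` inverts `u`: configuration `(a, t y; u, y)`
    have htu : t * u * t⁻¹ = u⁻¹ := (eq_inv_of_mul_eq_one_right hw)
    have hxz : (t * y) * a * (t * y)⁻¹ = a⁻¹ := by
      calc (t * y) * a * (t * y)⁻¹ = t * (y * a * y⁻¹) * t⁻¹ := by group
        _ = a⁻¹ := by rw [hy, hta]
    have hxu : (t * y) * u * (t * y)⁻¹ = u := by
      calc (t * y) * u * (t * y)⁻¹ = t * (y * u * y⁻¹) * t⁻¹ := by group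
        _ = (t * u * t⁻¹)⁻¹ := by rw [hyu]; group
        _ = u := by rw [htu, inv_inv]
    have hxy : (t * y) * y = y * (t * y) := by
      calc (t * y) * y = t * (y * y) := mul_assoc _ _ _
        _ = (y * y) * t := by rw [hy2, mul_one, one_mul]
        _ = y * (t * y) := by rw [mul_assoc, ← hty]
    exact S3S3Config.not_boxUseful ha3 hu3 hzu hxz hxu hy hyu hxy ha1 hu1 hG
  · -- `w ≠ 1`: configuration `(a, t; w, y)`
    exact S3S3Config.not_boxUseful ha3 hw3 haw hta htw hy hyw hty ha1 hw hG

/-- **A signed centraliser is impossible.**  `G` box-useful; `a ≠ 1 = a³` with every element centralising or inverting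
`a`, `t` an inverter; on `C = C_G(a)` a sign `ε = ±1`, multiplicative, with: elements of sign `+1` pairwise commute and have
cube `1`; `y ∈ C` an involution of sign `−1`; `u ∈ C`, `u ≠ 1 = u³`, inverted by `y`.  Then `False`. [folklore] -/
theorem false_of_signed_centralizer (hG : BoxUseful G) {a t y u : G} (ε : G → ZMod 3)
    (ha3 : a ^ 3 = 1) (ha1 : a ≠ 1) (hta : t * a * t⁻¹ = a⁻¹)
    (hsign : ∀ c : G, c * a * c⁻¹ = a → ε c = 1 ∨ ε c = -1)
    (hmul : ∀ c d : G, c * a * c⁻¹ = a → d * a * d⁻¹ = a → ε (c * d) = ε c * ε d)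
    (hcomm : ∀ c d : G, c * a * c⁻¹ = a → d * a * d⁻¹ = a → ε c = 1 → ε d = 1 → c * d = d * c)
    (hcube : ∀ c : G, c * a * c⁻¹ = a → ε c = 1 → c ^ 3 = 1)
    (hy : y * a * y⁻¹ = a) (hεy : ε y = -1) (hy2 : y * y = 1)
    (hu : u * a * u⁻¹ = a) (hu3 : u ^ 3 = 1) (hu1 : u ≠ 1) (hyu : y * u * y⁻¹ = u⁻¹) : False := by
  have haa : a * a * a⁻¹ = a := by group
  have h1 : (1 : G) * a * 1⁻¹ = a := by group
  -- `ε 1 = 1`, `ε = 1` on elements of cube `1`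
  have hε1 : ε 1 = 1 := by
    have e := hmul 1 1 h1 h1
    rw [mul_one] at e
    rcases hsign 1 h1 with h | h
    · exact h
    · rw [h] at e; exact absurd e (by decide)
  have hε3 : ∀ c : G, c * a * c⁻¹ = a → c ^ 3 = 1 → ε c = 1 := by
    intro c hc hc3
    rcases hsign c hc with h | h
    · exact h
    · exfalso
      have e : ε (c * c * c) = ε c * ε c * ε c := by rw [hmul _ _ (cent_mul hc hc) hc, hmul _ _ hc hc]
      rw [← pow_three', hc3, hε1, h] at e
      exact absurd e (by decide)
  have hyinv : y⁻¹ = y := by rw [inv_eq_iff_mul_eq_one, hy2]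
  have hεu : ε u = 1 := hε3 u hu hu3
  have htt := sq_cent_of_inverter hta
  rcases hsign _ htt with hεtt | hεtt
  swap
  · -- `ε(t²) = −1`: the faithful `C₃² ⋊ C₄` configuration on `u`, `x = t`
    have hv : (t * u * t⁻¹) * a * (t * u * t⁻¹)⁻¹ = a := cent_conj_of_inverter hta hu
    have hv3 : (t * u * t⁻¹) ^ 3 = 1 := by rw [CentreLift.conj_pow', hu3]; group
    have huv : u * (t * u * t⁻¹) = (t * u * t⁻¹) * u := hcomm _ _ hu hv hεu (hε3 _ hv hv3)
    have hs : ε (t * t * y) = 1 := by rw [hmul _ _ htt hy, hεtt, hεy]; decide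
    have hui : ε u⁻¹ = 1 := by
      rw [show u⁻¹ = u * u by rw [inv_eq_iff_mul_eq_one, ← pow_three, hu3]]  -- u⁻¹ = u²
      exact hε3 _ (cent_mul hu hu) (by rw [← pow_two, ← pow_mul, show 2 * 3 = 3 * 2 by rfl, pow_mul, hu3, one_pow])
    have hsu : (t * t * y) * u⁻¹ = u⁻¹ * (t * t * y) := hcomm _ _ (cent_mul htt hy) (cent_inv hu) hs hui
    have hyu2 : y⁻¹ * u * y = u⁻¹ := by
      rw [hyinv]
      calc y * u * y = y * u * y⁻¹ := by rw [hyinv]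
        _ = u⁻¹ := hyu
    have hx2 : t * t * u * t⁻¹ * t⁻¹ = u⁻¹ := by
      calc t * t * u * t⁻¹ * t⁻¹ = (t * t * y) * (y⁻¹ * u * y) * (t * t * y)⁻¹ := by group
        _ = (t * t * y) * u⁻¹ * (t * t * y)⁻¹ := by rw [hyu2]
        _ = u⁻¹ * (t * t * y) * (t * t * y)⁻¹ := by rw [hsu]
        _ = u⁻¹ := by group
    exact C3C3C4Config.not_boxUseful hu3 huv hx2 hu1 hG
  · -- `ε(t²) = 1`: replace `t` by `t c` commuting with `y`
    -- the involution `j = t⁻¹ y t` of `C` has sign `−1`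
    have hj : (t⁻¹ * y * t) * a * (t⁻¹ * y * t)⁻¹ = a := cent_conj_of_inverter' hta hy
    have hj2 : (t⁻¹ * y * t) * (t⁻¹ * y * t) = 1 := by
      rw [show (t⁻¹ * y * t) * (t⁻¹ * y * t) = t⁻¹ * (y * y) * t by group, hy2]; group
    have hεj : ε (t⁻¹ * y * t) = -1 := by
      rcases hsign _ hj with h | h
      · exfalso
        have h3 := hcube _ hj h
        have hj1 : t⁻¹ * y * t = 1 := C3C3C4Config.eq_one_of_sq h3 (by rw [pow_two]; exact hj2)
        have hy1 : y = 1 := by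
          calc y = t * (t⁻¹ * y * t) * t⁻¹ := by group
            _ = 1 := by rw [hj1]; group
        rw [hy1, hε1] at hεy
        exact absurd hεy (by decide)
      · exact h
    -- `m = j y` has sign `+1`, cube `1`, and is inverted by `y`; `c = m²` conjugates `y` to `j`
    have hm : (t⁻¹ * y * t * y) * a * (t⁻¹ * y * t * y)⁻¹ = a := cent_mul hj hy
    have hεm : ε (t⁻¹ * y * t * y) = 1 := by rw [hmul _ _ hj hy, hεj, hεy]; decide
    have hm3 : (t⁻¹ * y * t * y) ^ 3 = 1 := hcube _ hm hεm
    have hjinv : (t⁻¹ * y * t)⁻¹ = t⁻¹ * y * t := by rw [inv_eq_iff_mul_eq_one, hj2]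
    have hym : y * (t⁻¹ * y * t * y) * y⁻¹ = (t⁻¹ * y * t * y)⁻¹ := by
      calc y * (t⁻¹ * y * t * y) * y⁻¹ = y * (t⁻¹ * y * t) := by group
        _ = y⁻¹ * (t⁻¹ * y * t)⁻¹ := by rw [hyinv, hjinv]
        _ = (t⁻¹ * y * t * y)⁻¹ := by group
    set m := t⁻¹ * y * t * y with hmdef
    have hc : (m * m) * a * (m * m)⁻¹ = a := cent_mul hm hm
    have hcy : (m * m) * y * (m * m)⁻¹ = t⁻¹ * y * t := by
      have e1 : y * m⁻¹ = m * y := by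
        have := hym
        rw [hyinv] at this
        calc y * m⁻¹ = y * (y * m * y) := by rw [this]
          _ = (y * y) * m * y := by group
          _ = m * y := by rw [hy2, one_mul]
      have em3 : m * m * m = 1 := by rw [← pow_three', hm3]
      calc (m * m) * y * (m * m)⁻¹ = m * m * (y * m⁻¹) * m⁻¹ := by group
        _ = m * m * (m * y) * m⁻¹ := by rw [e1]
        _ = (m * m * m) * (y * m⁻¹) := by group
        _ = m * y := by rw [em3, one_mul, e1]
        _ = t⁻¹ * y * t * y * y := by rw [hmdef]
        _ = t⁻¹ * y * t * (y * y) := by group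
        _ = t⁻¹ * y * t := by rw [hy2, mul_one]
    clear_value m
    -- the new inverter `t' = t c`
    have ht' : (t * (m * m)) * a * (t * (m * m))⁻¹ = a⁻¹ := by
      calc (t * (m * m)) * a * (t * (m * m))⁻¹ = t * ((m * m) * a * (m * m)⁻¹) * t⁻¹ := by group
        _ = a⁻¹ := by rw [hc, hta]
    have ht'y : (t * (m * m)) * y = y * (t * (m * m)) := by
      have : (t * (m * m)) * y * (t * (m * m))⁻¹ = y := by
        calc (t * (m * m)) * y * (t * (m * m))⁻¹ = t * ((m * m) * y * (m * m)⁻¹) * t⁻¹ := by group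
          _ = y := by rw [hcy]; group
      rw [← mul_inv_eq_iff_eq_mul]; exact this
    -- `ε(t'²) = 1`
    have hmc3 : (t⁻¹ * (m * m) * t) ^ 3 = 1 := by
      have : t⁻¹ * (m * m) * t = t⁻¹ * (m * m) * t⁻¹⁻¹ := by rw [inv_inv]
      rw [this, CentreLift.conj_pow', (Commute.refl m).mul_pow, hm3]; group
    have hmc : (t⁻¹ * (m * m) * t) * a * (t⁻¹ * (m * m) * t)⁻¹ = a := cent_conj_of_inverter' hta hc
    have hεc : ε (m * m) = 1 := by rw [hmul _ _ hm hm, hεm]; decide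
    have hεt't' : ε ((t * (m * m)) * (t * (m * m))) = 1 := by
      rw [show (t * (m * m)) * (t * (m * m)) = (t * t) * (t⁻¹ * (m * m) * t) * (m * m) by group,
        hmul _ _ (cent_mul htt hmc) hc, hmul _ _ htt hmc, hεtt, hε3 _ hmc hmc3, hεc]; decide
    exact false_of_signed_aux hG ε ha3 ha1 ht' hcomm hε3 hy hy2 hu hu3 hu1 hyu ht'y hεt't'

end Endgame

end Summit.MatrixMultiplication.OmegaCensus
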